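import Summits.QuantumAdvantage.QuantumAdvantage.Theorems.LinnikCubicClassGroupsDegreeOnePrimesEscapeOdlyzkoDiscriminantBoundNumeric
import Summits.QuantumAdvantage.QuantumAdvantage.Theorems.LinnikCubicClassGroupsDegreeOnePrimesEscapeHilbertClassFieldDegree
import HarnessLib

/-!
# The Masley–Montgomery principle below root discriminant `2πe^{γ+0.59} ≈ 20.19`

Topic `Summits/QuantumAdvantage/QuantumAdvantage/Theorems`, helper file for the crux
`DegreeOnePrimesEscape` (stmt-QuantumAdvantage-11543, closed) of route `LinnikCubicClassGroups`;
cell B2b-1 (linnik-cubic), PART A. HONEST FRAMING: the value of this file is a THEOREM (explicit,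
kernel-checked) — NOT summit progress.

The tree's `Discriminant.finrank_le_of_natAbs_discr_eq_pow` / `classNumber_mul_finrank_le`
(Masley–Montgomery with Stark's constant) apply to number fields of root discriminant below
`2πe^γ ≈ 11.19`.  With Odlyzko's differencing bound of the companion files
(`OdlyzkoBound.log_absdiscr_ge_odlyzko_signature`:
`log|d_L| ≥ r₁(log 4π + γ + 0.838) + 2r₂(log 2π + γ + 0.59) − 2√(π²N/2) − 60`, `N = [L:ℚ]`) the same
principle reaches every number field `K` of degree `n` with

  `log|d_K| < n·(log 2π + γ + 0.59)`, i.e. root discriminant `|d_K|^{1/n} < 2πe^{γ+0.59} ≈ 20.19`.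

Put `A = log 2π + γ + 0.59` and `B'(K) = ((π√2 + 60)·n / (nA − log|d_K|))²`.  Then:

* `finrank_le_of_natAbs_discr_eq_pow_odlyzko` — every number field `L ⊇ K` with
  `|d_L| = |d_K|^{[L:K]}` has `[L:ℚ] ≤ B'(K)`; `finrank_le_of_unramified_odlyzko` — in particular
  every extension unramified at all finite primes;
* `prime_dvd_classNumber_le_odlyzko`, `card_range_classGroupChar_le_odlyzko` — every prime `p ∣ h_K`
  has `p·n ≤ B'(K)`, every character `ψ` of `Cl(𝓞_K)` has `|ψ(Cl)|·n ≤ B'(K)` (class field theory,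
  as in the tree's Stark-constant versions);
* `classNumber_mul_finrank_le_odlyzko` — **`h_K · n ≤ B'(K)`** (the tree's Hilbert-class-field datum
  of degree `≥ h_K`);
* `log_absdiscr_ge_of_classNumber_odlyzko` — conversely, for EVERY number field `K` of degree `n`:
  **`log|d_K| ≥ n(log 2π + γ + 0.59) − (π√2 + 60)·√(n/h_K)`**, i.e.
  `|d_K|^{1/n} ≥ 2πe^{γ+0.59}·e^{−(π√2+60)/√(n·h_K)}`.

## References

* J. M. Masley, H. L. Montgomery, *Cyclotomic fields with unique factorization*, J. reine angew.
  Math. 286/287 (1976) 248–256 (method). [MasleyMontgomery1976]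
* A. M. Odlyzko, *Lower bounds for discriminants of number fields. II*, Tôhoku Math. J. 29 (1977)
  209–216. [Odlyzko1977]
-/

noncomputable section

open scoped NumberField nonZeroDivisors
open Complex Filter Topology Set NumberField NumberField.InfinitePlace IsDedekindDomain

namespace Summit.QuantumAdvantage.QuantumAdvantage.Theorems.DegreeOnePrimesEscape

namespace OdlyzkoBound

open Literature.NumberTheory.LFunctions Literature.NumberTheory.LFunctions.NumberField
  Literature.NumberTheory.NumberFields

/-! ### Bounded degree of extensions with `|d_L| = |d_K|^{[L:K]}` -/

/-- **Degree bound for extensions with no relative discriminant, below root discriminant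
`2πe^{γ+0.59}`.**  Let `K ⊆ L` be number fields with `|d_L| = |d_K|^{[L:K]}` and
`log|d_K| < [K:ℚ](log 2π + γ + 0.59)`.  Then
`[L:ℚ] ≤ ((π√2 + 60)[K:ℚ] / ([K:ℚ](log 2π + γ + 0.59) − log|d_K|))²`.
[cite: MasleyMontgomery1976, §1 (method)] -/
theorem finrank_le_of_natAbs_discr_eq_pow_odlyzko (K L : Type*) [Field K] [NumberField K] [Field L]
    [NumberField L] [Algebra K L]
    (hunr : (discr L).natAbs = (discr K).natAbs ^ Module.finrank K L)
    (hsmall : Real.log ((discr K).natAbs : ℝ) <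
      Module.finrank ℚ K * (Real.log (2 * Real.pi) + Real.eulerMascheroniConstant + 0.59)) :
    (Module.finrank ℚ L : ℝ) ≤
      ((Real.pi * Real.sqrt 2 + 60) * Module.finrank ℚ K /
        (Module.finrank ℚ K * (Real.log (2 * Real.pi) + Real.eulerMascheroniConstant + 0.59) -
          Real.log ((discr K).natAbs : ℝ))) ^ 2 := by
  set n : ℕ := Module.finrank ℚ K with hn_def
  set m : ℕ := Module.finrank K L with hm_def
  set N : ℕ := Module.finrank ℚ L with hN_def
  set A : ℝ := Real.log (2 * Real.pi) + Real.eulerMascheroniConstant + 0.59 with hA_def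
  set ℓ : ℝ := Real.log ((discr K).natAbs : ℝ) with hℓ_def
  have hπ0 := Real.pi_pos
  have hn1 : (1 : ℝ) ≤ n := by rw [hn_def]; exact_mod_cast Module.finrank_pos
  have hN1 : (1 : ℝ) ≤ N := by rw [hN_def]; exact_mod_cast Module.finrank_pos
  have hNnm : (N : ℝ) = n * m := by
    rw [hN_def, hn_def, hm_def]; exact_mod_cast (Module.finrank_mul_finrank ℚ K L).symm
  -- `log|d_L| = m · log|d_K|`
  have hlogL : Real.log ((discr L).natAbs : ℝ) = m * ℓ := by
    rw [hunr]; push_cast; rw [Real.log_pow]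
  -- Odlyzko's bound for `L`
  have hS := log_absdiscr_ge_odlyzko_signature L
  have hrank : (nrRealPlaces L : ℝ) + 2 * nrComplexPlaces L = N := by
    rw [hN_def]; exact_mod_cast card_add_two_mul_card_eq_rank L
  have hr1 : (0 : ℝ) ≤ nrRealPlaces L := Nat.cast_nonneg _
  have h42 : Real.log (2 * Real.pi) + Real.eulerMascheroniConstant + 0.59 ≤
      Real.log (4 * Real.pi) + Real.eulerMascheroniConstant + 0.838 := by
    have := Real.log_le_log (by positivity : 0 < 2 * Real.pi) (by linarith : 2 * Real.pi ≤ 4 * Real.pi)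
    linarith
  have e1 := mul_le_mul_of_nonneg_left h42 hr1
  -- `2√(π²N/2) = π√2·√N`, `s = √N ≥ 1`
  set s : ℝ := Real.sqrt N with hs_def
  have hs1 : 1 ≤ s := by rw [hs_def]; exact Real.one_le_sqrt.2 hN1
  have hs2 : s ^ 2 = N := by rw [hs_def, Real.sq_sqrt (by linarith)]
  have hsq : 2 * Real.sqrt (Real.pi ^ 2 * (N : ℝ) / 2) = Real.pi * Real.sqrt 2 * s := by
    rw [Real.sqrt_div' _ (by norm_num : (0 : ℝ) ≤ 2), Real.sqrt_mul (sq_nonneg Real.pi),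
      Real.sqrt_sq hπ0.le, ← hs_def,
      show 2 * (Real.pi * s / Real.sqrt 2) = Real.pi * s * (2 / Real.sqrt 2) by ring, Real.div_sqrt]
    ring
  rw [hN_def] at hsq
  rw [hsq] at hS
  -- `N · δ ≤ (π√2 + 60) s · n` with `δ = nA − ℓ > 0`
  have hδ : 0 < n * A - ℓ := by linarith
  have hkey : (N : ℝ) * (n * A - ℓ) ≤ (Real.pi * Real.sqrt 2 + 60) * s * n := by
    have hNA : (N : ℝ) * A = (nrRealPlaces L : ℝ) * (Real.log (2 * Real.pi) +
        Real.eulerMascheroniConstant + 0.59) + 2 * (nrComplexPlaces L : ℝ) *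
          (Real.log (2 * Real.pi) + Real.eulerMascheroniConstant + 0.59) := by
      rw [← hrank, hA_def]; ring
    have h1 : (N : ℝ) * A - Real.pi * Real.sqrt 2 * s - 60 ≤ m * ℓ := by
      rw [← hlogL]; linarith [hS, e1, hNA]
    have h2 : (60 : ℝ) ≤ 60 * s := by linarith
    have h3 : (N : ℝ) * (n * A - ℓ) = n * (N * A - m * ℓ) := by rw [hNnm]; ring
    rw [h3]
    have h4 : (N : ℝ) * A - m * ℓ ≤ (Real.pi * Real.sqrt 2 + 60) * s := by nlinarith
    have hn0 : (0 : ℝ) ≤ n := by linarith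
    nlinarith
  -- divide by `s` and square
  have hsδ : s * (n * A - ℓ) ≤ (Real.pi * Real.sqrt 2 + 60) * n := by
    have : s * (s * (n * A - ℓ)) ≤ s * ((Real.pi * Real.sqrt 2 + 60) * n) := by
      have := hkey; rw [← hs2] at this; nlinarith
    exact le_of_mul_le_mul_left this (by linarith)
  have hsle : s ≤ (Real.pi * Real.sqrt 2 + 60) * n / (n * A - ℓ) := by
    rw [le_div_iff₀ hδ]; exact hsδ
  calc (N : ℝ) = s ^ 2 := hs2.symm
    _ ≤ ((Real.pi * Real.sqrt 2 + 60) * n / (n * A - ℓ)) ^ 2 :=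
        pow_le_pow_left₀ (by linarith) hsle 2

/-- **Bounded degree of unramified extensions below root discriminant `2πe^{γ+0.59} ≈ 20.19`.**
If `log|d_K| < [K:ℚ](log 2π + γ + 0.59)`, then every number field `L ⊇ K` unramified at every nonzero
prime of `K` has `[L:ℚ] ≤ ((π√2 + 60)[K:ℚ] / ([K:ℚ](log 2π + γ + 0.59) − log|d_K|))²`.
[cite: MasleyMontgomery1976, §1 (method)] -/
theorem finrank_le_of_unramified_odlyzko (K L : Type*) [Field K] [NumberField K] [Field L]
    [NumberField L] [Algebra K L]
    (hunr : ∀ v : HeightOneSpectrum (𝓞 K), Algebra.IsUnramifiedIn (𝓞 L) v.asIdeal)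
    (hsmall : Real.log ((discr K).natAbs : ℝ) <
      Module.finrank ℚ K * (Real.log (2 * Real.pi) + Real.eulerMascheroniConstant + 0.59)) :
    (Module.finrank ℚ L : ℝ) ≤
      ((Real.pi * Real.sqrt 2 + 60) * Module.finrank ℚ K /
        (Module.finrank ℚ K * (Real.log (2 * Real.pi) + Real.eulerMascheroniConstant + 0.59) -
          Real.log ((discr K).natAbs : ℝ))) ^ 2 :=
  finrank_le_of_natAbs_discr_eq_pow_odlyzko K L (forall_isUnramifiedIn_iff_natAbs_discr_eq.mp hunr)
    hsmall

/-! ### Consequences for the class group (class field theory) -/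

/-- **Prime divisors of `h_K` below root discriminant `2πe^{γ+0.59}`**: if
`log|d_K| < [K:ℚ](log 2π + γ + 0.59)` and `p` is a prime dividing `h_K`, then
`p·[K:ℚ] ≤ ((π√2 + 60)[K:ℚ] / ([K:ℚ](log 2π + γ + 0.59) − log|d_K|))²`.
[cite: MasleyMontgomery1976, §1 (method)] -/
theorem prime_dvd_classNumber_le_odlyzko (K : Type) [Field K] [NumberField K] {p : ℕ} (hp : p.Prime)
    (hdvd : p ∣ classNumber K)
    (hsmall : Real.log ((discr K).natAbs : ℝ) <
      Module.finrank ℚ K * (Real.log (2 * Real.pi) + Real.eulerMascheroniConstant + 0.59)) :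
    ((p * Module.finrank ℚ K : ℕ) : ℝ) ≤
      ((Real.pi * Real.sqrt 2 + 60) * Module.finrank ℚ K /
        (Module.finrank ℚ K * (Real.log (2 * Real.pi) + Real.eulerMascheroniConstant + 0.59) -
          Real.log ((discr K).natAbs : ℝ))) ^ 2 := by
  obtain ⟨E, hfd, hgal, hcyc, hcard, hunr⟩ :=
    exists_unramified_isCyclic_card_eq_of_prime_dvd_classNumber (K := K) hp hdvd
  haveI := hfd
  haveI := hgal
  haveI : NumberField E := NumberField.of_module_finite K E
  have hdeg : Module.finrank K E = p := by rw [← IsGalois.card_aut_eq_finrank, ← hcard]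
  have hN : Module.finrank ℚ E = p * Module.finrank ℚ K := by
    rw [← Module.finrank_mul_finrank ℚ K E, hdeg, mul_comm]
  have h := finrank_le_of_unramified_odlyzko K E hunr hsmall
  rwa [hN] at h

/-- **Orders of class-group characters below root discriminant `2πe^{γ+0.59}`**: if
`log|d_K| < [K:ℚ](log 2π + γ + 0.59)`, then every character `ψ : Cl(𝓞_K) → ℂˣ` satisfies
`|ψ(Cl(𝓞_K))|·[K:ℚ] ≤ ((π√2 + 60)[K:ℚ] / ([K:ℚ](log 2π + γ + 0.59) − log|d_K|))²`; in particular the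
exponent of the class group is at most this bound divided by `[K:ℚ]`.
[cite: MasleyMontgomery1976, §1 (method)] -/
theorem card_range_classGroupChar_le_odlyzko (K : Type) [Field K] [NumberField K]
    (ψ : ClassGroup (𝓞 K) →* ℂˣ)
    (hsmall : Real.log ((discr K).natAbs : ℝ) <
      Module.finrank ℚ K * (Real.log (2 * Real.pi) + Real.eulerMascheroniConstant + 0.59)) :
    ((Nat.card ψ.range * Module.finrank ℚ K : ℕ) : ℝ) ≤
      ((Real.pi * Real.sqrt 2 + 60) * Module.finrank ℚ K /
        (Module.finrank ℚ K * (Real.log (2 * Real.pi) + Real.eulerMascheroniConstant + 0.59) -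
          Real.log ((discr K).natAbs : ℝ))) ^ 2 := by
  obtain ⟨E, hfd, hgal, χ, hcomm, hinj, hunr, hfrob⟩ := exists_classField_char_frobenius ψ
  haveI := hfd
  haveI := hgal
  haveI : NumberField E := NumberField.of_module_finite K E
  have hdeg : Module.finrank K E = Nat.card ψ.range :=
    finrank_eq_card_range_of_classField ψ E χ hcomm hinj hfrob
  have hN : Module.finrank ℚ E = Nat.card ψ.range * Module.finrank ℚ K := by
    rw [← Module.finrank_mul_finrank ℚ K E, hdeg, mul_comm]
  have h := finrank_le_of_unramified_odlyzko K E hunr hsmall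
  rwa [hN] at h

/-- **Masley–Montgomery below root discriminant `2πe^{γ+0.59} ≈ 20.19`: bounded class number.**
If `log|d_K| < n(log 2π + γ + 0.59)` (`n = [K:ℚ]`), then
`h_K · n ≤ ((π√2 + 60)·n / (n(log 2π + γ + 0.59) − log|d_K|))²`.
[cite: MasleyMontgomery1976, §1 (method)] -/
theorem classNumber_mul_finrank_le_odlyzko (K : Type) [Field K] [NumberField K]
    (hsmall : Real.log ((discr K).natAbs : ℝ) <
      Module.finrank ℚ K * (Real.log (2 * Real.pi) + Real.eulerMascheroniConstant + 0.59)) :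
    ((classNumber K * Module.finrank ℚ K : ℕ) : ℝ) ≤
      ((Real.pi * Real.sqrt 2 + 60) * Module.finrank ℚ K /
        (Module.finrank ℚ K * (Real.log (2 * Real.pi) + Real.eulerMascheroniConstant + 0.59) -
          Real.log ((discr K).natAbs : ℝ))) ^ 2 := by
  obtain ⟨H, hfd, hgal, hunr, hle⟩ := Discriminant.exists_unramified_classNumber_le_finrank K
  haveI := hfd
  haveI : NumberField H := NumberField.of_module_finite K H
  have h := finrank_le_of_natAbs_discr_eq_pow_odlyzko K H
    (natAbs_discr_eq_pow_of_forall_isUnramifiedAt hunr) hsmall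
  have hN : Module.finrank ℚ H = Module.finrank K H * Module.finrank ℚ K := by
    rw [← Module.finrank_mul_finrank ℚ K H, mul_comm]
  rw [hN] at h
  refine le_trans ?_ h
  exact_mod_cast Nat.mul_le_mul_right _ hle

/-! ### Converse readings -/

/-- Real-variable step: if `ℓ < nA` implies `m·n ≤ (Bn/(nA − ℓ))²`, then `ℓ ≥ nA − B√(n/m)`.
[folklore] -/
private theorem le_of_imp_mul_le_sq {n m A ℓ B : ℝ} (hn : 0 < n) (hm : 0 < m) (hB : 0 ≤ B)
    (h : ℓ < n * A → m * n ≤ (B * n / (n * A - ℓ)) ^ 2) :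
    n * A - B * Real.sqrt (n / m) ≤ ℓ := by
  by_contra hlt
  push Not at hlt
  have hs0 : 0 ≤ Real.sqrt (n / m) := Real.sqrt_nonneg _
  have hδ : 0 < n * A - ℓ := by nlinarith
  have h1 := h (by nlinarith)
  have hq : 0 ≤ B * n / (n * A - ℓ) := by positivity
  have h2 : Real.sqrt (m * n) ≤ B * n / (n * A - ℓ) := by
    rw [← Real.sqrt_sq hq]; exact Real.sqrt_le_sqrt h1
  have h3 : (n * A - ℓ) * Real.sqrt (m * n) ≤ B * n := by
    have := mul_le_mul_of_nonneg_left h2 hδ.le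
    rwa [mul_div_cancel₀ _ hδ.ne'] at this
  have hmn : 0 < Real.sqrt (m * n) := Real.sqrt_pos.2 (by positivity)
  have h4 : B * n = B * Real.sqrt (n / m) * Real.sqrt (m * n) := by
    rw [mul_assoc, ← Real.sqrt_mul (by positivity),
      show n / m * (m * n) = n ^ 2 by field_simp, Real.sqrt_sq hn.le]
  rw [h4] at h3
  have h5 : n * A - ℓ ≤ B * Real.sqrt (n / m) := le_of_mul_le_mul_right h3 hmn
  linarith

/-- **A large class number forces a large root discriminant**: for EVERY number field `K` of degree
`n`, `log|d_K| ≥ n(log 2π + γ + 0.59) − (π√2 + 60)·√(n/h_K)`, i.e.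
`|d_K|^{1/n} ≥ 2πe^{γ+0.59}·e^{−(π√2+60)/√(n·h_K)} ≈ 20.19·e^{−64.45/√(n·h_K)}`.
[cite: MasleyMontgomery1976, §1 (method)] -/
theorem log_absdiscr_ge_of_classNumber_odlyzko (K : Type) [Field K] [NumberField K] :
    Module.finrank ℚ K * (Real.log (2 * Real.pi) + Real.eulerMascheroniConstant + 0.59) -
        (Real.pi * Real.sqrt 2 + 60) * Real.sqrt (Module.finrank ℚ K / classNumber K) ≤
      Real.log ((discr K).natAbs : ℝ) := by
  have hn : (0 : ℝ) < Module.finrank ℚ K := by exact_mod_cast Module.finrank_pos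
  have hm : (0 : ℝ) < classNumber K := by exact_mod_cast classNumber_pos K
  refine le_of_imp_mul_le_sq hn hm (by positivity) fun hsmall ↦ ?_
  have h := classNumber_mul_finrank_le_odlyzko K hsmall
  push_cast at h
  exact h

/-- **A class-group character of large order forces a large root discriminant**: for every number
field `K` of degree `n` and every character `ψ` of `Cl(𝓞_K)` with `|ψ(Cl)| = m`,
`log|d_K| ≥ n(log 2π + γ + 0.59) − (π√2 + 60)√(n/m)`. [cite: MasleyMontgomery1976, §1 (method)] -/
theorem log_absdiscr_ge_of_classGroupChar_odlyzko (K : Type) [Field K] [NumberField K]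
    (ψ : ClassGroup (𝓞 K) →* ℂˣ) :
    Module.finrank ℚ K * (Real.log (2 * Real.pi) + Real.eulerMascheroniConstant + 0.59) -
        (Real.pi * Real.sqrt 2 + 60) * Real.sqrt (Module.finrank ℚ K / Nat.card ψ.range) ≤
      Real.log ((discr K).natAbs : ℝ) := by
  haveI : Finite ψ.range := inferInstance
  have hm : (0 : ℝ) < Nat.card ψ.range := by exact_mod_cast Nat.card_pos
  have hn : (0 : ℝ) < Module.finrank ℚ K := by exact_mod_cast Module.finrank_pos
  refine le_of_imp_mul_le_sq hn hm (by positivity) fun hsmall ↦ ?_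
  have h := card_range_classGroupChar_le_odlyzko K ψ hsmall
  push_cast at h
  exact h

/-- **A prime divisor of the class number forces a large root discriminant**: if `p ∣ h_K` then
`log|d_K| ≥ n(log 2π + γ + 0.59) − (π√2 + 60)√(n/p)`. [cite: MasleyMontgomery1976, §1 (method)] -/
theorem log_absdiscr_ge_of_prime_dvd_classNumber_odlyzko (K : Type) [Field K] [NumberField K]
    {p : ℕ} (hp : p.Prime) (hdvd : p ∣ classNumber K) :
    Module.finrank ℚ K * (Real.log (2 * Real.pi) + Real.eulerMascheroniConstant + 0.59) -
        (Real.pi * Real.sqrt 2 + 60) * Real.sqrt (Module.finrank ℚ K / p) ≤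
      Real.log ((discr K).natAbs : ℝ) := by
  have hm : (0 : ℝ) < p := by exact_mod_cast hp.pos
  have hn : (0 : ℝ) < Module.finrank ℚ K := by exact_mod_cast Module.finrank_pos
  refine le_of_imp_mul_le_sq hn hm (by positivity) fun hsmall ↦ ?_
  have h := prime_dvd_classNumber_le_odlyzko K hp hdvd hsmall
  push_cast at h
  exact h

end OdlyzkoBound

end Summit.QuantumAdvantage.QuantumAdvantage.Theorems.DegreeOnePrimesEscape
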